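import Mathlib
import HarnessLib
import Summits.ValiantsHypothesis.ValiantsHypothesis.Theorems.LacunarySymmetroidMatrixDescartesOsculationLawCuspCubicCountPrelim
import Summits.ValiantsHypothesis.ValiantsHypothesis.Theorems.LacunarySymmetroidMatrixDescartesOsculationLawCuspQuarticPrelim

/-!
# ValiantsHypothesis / LacunarySymmetroid — crux `MatrixDescartes` (stmt-ValiantsHypothesis-18050, V1),
# line «osculation-law»: the MONIC QUARTIC cusp curve — the count in the CUBIC-REMAINDER regime with a
# LINEAR second remainder (`R₃ ≢ 0`, `ℓ₂ ≡ 0`)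

Regime A″ of the `(4,0)` case tree (desk RULING #260 (b)).  The Hessian remainder `R = R₃b³ + R₂b² + R₁b + R₀`
(`OsculationCuspQuartic.hess_reduce_poly4`) has `R₃ ≢ 0`; the first Euclid step
`R₃²Φ = (R₃b + (σ₁R₃ − R₂))·R + ℓ₂b² + ℓ₁b + ℓ₀` (`OsculationCuspQuartic.euclid4_step1`) has `ℓ₂ ≡ 0` as a polynomial
in `t`, so on the curve `ℓ₁(t)b + ℓ₀(t) = 0`.  ABSTRACT in `σ₁ … σ₄ R₃ … R₀ : ℝ[X]` (no pencil, no algebra import):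
`#osc ≤ |supp N₁| + 4(|supp R₃| + |supp ℓ₁| + |supp ℓ₀|)`, `N₁ = R₀ℓ₁³ − R₁ℓ₀ℓ₁² + R₂ℓ₀²ℓ₁ − R₃ℓ₀³` (`= ℓ₁³·R(−ℓ₀/ℓ₁)`).
Strata: `{R₃(t) = 0}` and `{ℓ₁(t) = 0}` are fibres (≤ 4 ordinates, `fibre_four_le`); the generic stratum injects into
`Z₊(N₁)` or — if `N₁ ≡ 0` — is an open arc `b = −ℓ₀/ℓ₁` of osculation points (absurd by finiteness); `ℓ ≡ 0` makes
`R(t,·)` a factor of `R₃(t)²Φ(t,·)`, hence real-rooted (`cubic_prod_of_dvd_quartic`, Mathlib `Splits.of_dvd`), and a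
positive root of `R` PERSISTS along an arc by the non-monic Vieta signs (`OsculationCuspCubic.sign_of_pos_root` /
`exists_pos_root_of_sign`) — absurd again.  Siblings: `…CuspQuarticCountLow` (`R₃ ≡ 0`), `…CuspQuarticCountHigh`
(`R₃ ≢ 0`, `ℓ₂ ≢ 0`: second cascade level, to be written), then the assembly with the `(4,0)` pencil.

Honest framing: helper count for a located rung piece of an UNREGISTERED V1 law line; `OsculationLaw`,
`PeelInequality`, `MatrixDescartes`, Conjecture B and `VP ≠ VNP` are OPEN / NOT proved.  No definitions, no named facts.
-/

-- `Summit.ValiantsHypothesis.ValiantsHypothesis.…` is the tree's mandated single-conjunct layout (Sub = Summit).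
set_option linter.dupNamespace false

noncomputable section

namespace Summit.ValiantsHypothesis.ValiantsHypothesis.Theorems.LacunarySymmetroidMatrixDescartes

open Polynomial Set
open scoped BigOperators
open OsculationCuspCubic

namespace OsculationCuspQuartic

set_option maxHeartbeats 1600000 in
/-- **Quartic cusp curve, cubic remainder with linear second remainder — the count.**  See the module docstring.
[folklore] -/
theorem quartic_high_lin_ncard_le (σ₁ σ₂ σ₃ σ₄ R₃ R₂ R₁ R₀ : ℝ[X]) (osc : Set (Fin 2 → ℝ)) (hR3 : R₃ ≠ 0)
    (hl2 : σ₂ * R₃ ^ 2 - R₁ * R₃ - σ₁ * R₂ * R₃ + R₂ ^ 2 = 0)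
    (hout : ∀ p ∈ osc, 0 < p 0 ∧ 0 < p 1 ∧
      p 1 ^ 4 + p 1 ^ 3 * σ₁.eval (p 0) + p 1 ^ 2 * σ₂.eval (p 0) + p 1 * σ₃.eval (p 0) + σ₄.eval (p 0) = 0 ∧
      R₃.eval (p 0) * p 1 ^ 3 + R₂.eval (p 0) * p 1 ^ 2 + R₁.eval (p 0) * p 1 + R₀.eval (p 0) = 0)
    (hin : ∀ t b : ℝ, 0 < t → 0 < b →
      b ^ 4 + b ^ 3 * σ₁.eval t + b ^ 2 * σ₂.eval t + b * σ₃.eval t + σ₄.eval t = 0 →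
      R₃.eval t * b ^ 3 + R₂.eval t * b ^ 2 + R₁.eval t * b + R₀.eval t = 0 → (![t, b] : Fin 2 → ℝ) ∈ osc)
    (hreal : ∀ t : ℝ, ∃ μ₁ μ₂ μ₃ μ₄ : ℝ, ∀ b : ℝ,
      b ^ 4 + b ^ 3 * σ₁.eval t + b ^ 2 * σ₂.eval t + b * σ₃.eval t + σ₄.eval t
        = (b - μ₁) * (b - μ₂) * (b - μ₃) * (b - μ₄))
    (hfin : osc.Finite) :
    osc.ncard ≤
      (R₀ * (σ₃ * R₃ ^ 2 - R₀ * R₃ - σ₁ * R₁ * R₃ + R₁ * R₂) ^ 3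
          - R₁ * (σ₄ * R₃ ^ 2 - σ₁ * R₀ * R₃ + R₀ * R₂) * (σ₃ * R₃ ^ 2 - R₀ * R₃ - σ₁ * R₁ * R₃ + R₁ * R₂) ^ 2
          + R₂ * (σ₄ * R₃ ^ 2 - σ₁ * R₀ * R₃ + R₀ * R₂) ^ 2 * (σ₃ * R₃ ^ 2 - R₀ * R₃ - σ₁ * R₁ * R₃ + R₁ * R₂)
          - R₃ * (σ₄ * R₃ ^ 2 - σ₁ * R₀ * R₃ + R₀ * R₂) ^ 3).support.card
      + 4 * (R₃.support.card + (σ₃ * R₃ ^ 2 - R₀ * R₃ - σ₁ * R₁ * R₃ + R₁ * R₂).support.card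
          + (σ₄ * R₃ ^ 2 - σ₁ * R₀ * R₃ + R₀ * R₂).support.card) := by
  classical
  set L₁ : ℝ[X] := σ₃ * R₃ ^ 2 - R₀ * R₃ - σ₁ * R₁ * R₃ + R₁ * R₂ with hL₁def
  set L₀ : ℝ[X] := σ₄ * R₃ ^ 2 - σ₁ * R₀ * R₃ + R₀ * R₂ with hL₀def
  set N : ℝ[X] := R₀ * L₁ ^ 3 - R₁ * L₀ * L₁ ^ 2 + R₂ * L₀ ^ 2 * L₁ - R₃ * L₀ ^ 3 with hNdef
  have hpos0 : ∀ p ∈ osc, 0 < p 0 := fun p hp => (hout p hp).1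
  have hpos1 : ∀ p ∈ osc, 0 < p 1 := fun p hp => (hout p hp).2.1
  have hcub : ∀ p ∈ osc,
      p 1 ^ 4 + p 1 ^ 3 * σ₁.eval (p 0) + p 1 ^ 2 * σ₂.eval (p 0) + p 1 * σ₃.eval (p 0) + σ₄.eval (p 0) = 0 :=
    fun p hp => (hout p hp).2.2.1
  have hR : ∀ p ∈ osc,
      R₃.eval (p 0) * p 1 ^ 3 + R₂.eval (p 0) * p 1 ^ 2 + R₁.eval (p 0) * p 1 + R₀.eval (p 0) = 0 :=
    fun p hp => (hout p hp).2.2.2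
  -- the first Euclid step, evaluated, with `ℓ₂ ≡ 0`
  have hEuclid : ∀ t b : ℝ,
      R₃.eval t ^ 2 * (b ^ 4 + b ^ 3 * σ₁.eval t + b ^ 2 * σ₂.eval t + b * σ₃.eval t + σ₄.eval t) =
      (R₃.eval t * b + (σ₁.eval t * R₃.eval t - R₂.eval t))
        * (R₃.eval t * b ^ 3 + R₂.eval t * b ^ 2 + R₁.eval t * b + R₀.eval t)
        + (L₁.eval t * b + L₀.eval t) := by
    intro t b
    have h2 : (σ₂ * R₃ ^ 2 - R₁ * R₃ - σ₁ * R₂ * R₃ + R₂ ^ 2).eval t = 0 := by rw [hl2, eval_zero]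
    simp only [eval_add, eval_sub, eval_mul, eval_pow] at h2
    rw [hL₁def, hL₀def]
    simp only [eval_add, eval_sub, eval_mul, eval_pow]
    linear_combination b ^ 2 * h2
  have hNq : ∀ t b : ℝ, L₁.eval t * b + L₀.eval t = 0 →
      N.eval t = L₁.eval t ^ 3 * (R₃.eval t * b ^ 3 + R₂.eval t * b ^ 2 + R₁.eval t * b + R₀.eval t) := by
    intro t b h
    have h0 : L₀.eval t = -(L₁.eval t * b) := by linarith
    rw [hNdef]
    simp only [eval_add, eval_sub, eval_mul, eval_pow]
    rw [h0]
    ring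
  have hL : ∀ p ∈ osc, L₁.eval (p 0) * p 1 + L₀.eval (p 0) = 0 := by
    intro p hp
    have h := hEuclid (p 0) (p 1)
    rw [hcub p hp, hR p hp, mul_zero, mul_zero, zero_add] at h
    exact h.symm
  have hNroot : ∀ p ∈ osc, N.IsRoot (p 0) := by
    intro p hp
    rw [IsRoot.def, hNq (p 0) (p 1) (hL p hp), hR p hp, mul_zero]
  rcases Set.eq_empty_or_nonempty osc with hempty | hne
  · rw [hempty, Set.ncard_empty]; exact Nat.zero_le _
  set Sa : Set (Fin 2 → ℝ) := {p | p ∈ osc ∧ R₃.eval (p 0) = 0} with hSa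
  set Sg : Set (Fin 2 → ℝ) := {p | p ∈ osc ∧ R₃.eval (p 0) ≠ 0} with hSg
  have hsplit : osc = Sa ∪ Sg := by
    ext p
    simp only [hSa, hSg, Set.mem_union, Set.mem_setOf_eq]
    tauto
  have hSac : Sa.ncard ≤ 4 * R₃.support.card :=
    fibre_four_le σ₁ σ₂ σ₃ σ₄ R₃ hR3 Sa (fun p hp => ⟨hpos0 p hp.1, hp.2, hcub p hp.1⟩)
  have hSgc : Sg.ncard ≤ N.support.card + 4 * (L₁.support.card + L₀.support.card) := by
    by_cases hL1z : L₁ = 0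
    · have hL0v : ∀ p ∈ osc, L₀.eval (p 0) = 0 := by
        intro p hp
        have h := hL p hp
        rw [hL1z, eval_zero, zero_mul, zero_add] at h
        exact h
      by_cases hL0z : L₀ = 0
      · /- `ℓ ≡ 0`: `R(t,·)` divides `R₃(t)² Φ(t,·)`; a positive root of `R` persists (Vieta) along an arc -/
        have hSge : Sg = ∅ := by
          rcases Set.eq_empty_or_nonempty Sg with h | ⟨p, hp⟩
          · exact h
          exfalso
          have hR3p : R₃.eval (p 0) ≠ 0 := hp.2
          have hid : ∀ t b : ℝ,
              R₃.eval t ^ 2 * (b ^ 4 + b ^ 3 * σ₁.eval t + b ^ 2 * σ₂.eval t + b * σ₃.eval t + σ₄.eval t) =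
              (R₃.eval t * b + (σ₁.eval t * R₃.eval t - R₂.eval t))
                * (R₃.eval t * b ^ 3 + R₂.eval t * b ^ 2 + R₁.eval t * b + R₀.eval t) := by
            intro t b
            have h := hEuclid t b
            rw [hL1z, hL0z, eval_zero, zero_mul, add_zero, add_zero] at h
            exact h
          -- real-rootedness of `R(t,·)` wherever `R₃(t) ≠ 0`
          have hrealR : ∀ t : ℝ, R₃.eval t ≠ 0 → ∃ ν₁ ν₂ ν₃ : ℝ, ∀ b : ℝ,
              R₃.eval t * b ^ 3 + R₂.eval t * b ^ 2 + R₁.eval t * b + R₀.eval t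
                = R₃.eval t * ((b - ν₁) * (b - ν₂) * (b - ν₃)) := by
            intro t ht
            obtain ⟨μ₁, μ₂, μ₃, μ₄, hμ⟩ := hreal t
            exact cubic_prod_of_dvd_quartic (k₁ := R₃.eval t) (k₀ := σ₁.eval t * R₃.eval t - R₂.eval t)
              (μ₁ := μ₁) (μ₂ := μ₂) (μ₃ := μ₃) (μ₄ := μ₄) ht (pow_ne_zero 2 ht)
              (fun b => by rw [← hμ b]; exact (hid t b).symm)
          -- the sign window around `p 0`
          set W : Set ℝ := {t | R₂.eval t * R₃.eval t < 0 ∨ R₁.eval t * R₃.eval t < 0 ∨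
            R₀.eval t * R₃.eval t < 0} with hW
          have hWo : IsOpen W :=
            (isOpen_lt (R₂.continuous.mul R₃.continuous) continuous_const).union
              ((isOpen_lt (R₁.continuous.mul R₃.continuous) continuous_const).union
                (isOpen_lt (R₀.continuous.mul R₃.continuous) continuous_const))
          have hR3W : ∀ t ∈ W, R₃.eval t ≠ 0 := by
            intro t ht h0
            simp only [hW, Set.mem_setOf_eq, h0, mul_zero, lt_self_iff_false, or_self] at ht
          have hpW : p 0 ∈ W := sign_of_pos_root hR3p (hpos1 p hp.1) (hR p hp.1)
          apply hfin.not_infinite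
          refine OsculationCusp.infinite_of_curve (U := W ∩ Set.Ioi 0) (hWo.inter isOpen_Ioi) (t₀ := p 0)
            ⟨hpW, hpos0 p hp.1⟩
            (fun t => if h : t ∈ W then
              Classical.choose (exists_pos_root_of_sign (hR3W t h) (hrealR t (hR3W t h)) h) else 1) ?_
          intro t ht
          obtain ⟨htW, htpos⟩ := ht
          have hspec := Classical.choose_spec (exists_pos_root_of_sign (hR3W t htW) (hrealR t (hR3W t htW)) htW)
          set γ := Classical.choose (exists_pos_root_of_sign (hR3W t htW) (hrealR t (hR3W t htW)) htW) with hγ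
          obtain ⟨hγpos, hγroot⟩ := hspec
          have hquart : γ ^ 4 + γ ^ 3 * σ₁.eval t + γ ^ 2 * σ₂.eval t + γ * σ₃.eval t + σ₄.eval t = 0 := by
            have h := hid t γ
            rw [hγroot, mul_zero] at h
            rcases mul_eq_zero.1 h with h' | h'
            · exact absurd ((pow_eq_zero_iff (by norm_num)).1 h') (hR3W t htW)
            · exact h'
          have hmem := hin t γ htpos hγpos hquart hγroot
          simp only [dif_pos htW]
          exact hmem
        rw [hSge, Set.ncard_empty]; exact Nat.zero_le _
      · have h := fibre_four_le σ₁ σ₂ σ₃ σ₄ L₀ hL0z Sg (fun p hp => ⟨hpos0 p hp.1, hL0v p hp.1, hcub p hp.1⟩)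
        nlinarith [h, Nat.zero_le N.support.card, Nat.zero_le L₁.support.card]
    · set T0 : Set (Fin 2 → ℝ) := {p | p ∈ Sg ∧ L₁.eval (p 0) = 0} with hT0
      set T1 : Set (Fin 2 → ℝ) := {p | p ∈ Sg ∧ L₁.eval (p 0) ≠ 0} with hT1
      have hsplit' : Sg = T0 ∪ T1 := by
        ext p
        simp only [hT0, hT1, Set.mem_union, Set.mem_setOf_eq]
        tauto
      have hT0c : T0.ncard ≤ 4 * L₁.support.card :=
        fibre_four_le σ₁ σ₂ σ₃ σ₄ L₁ hL1z T0 (fun p hp => ⟨hpos0 p hp.1.1, hp.2, hcub p hp.1.1⟩)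
      have hT1c : T1.ncard ≤ N.support.card := by
        by_cases hNz : N = 0
        · have hT1e : T1 = ∅ := by
            rcases Set.eq_empty_or_nonempty T1 with h | ⟨p, hp⟩
            · exact h
            exfalso
            have hR3p : R₃.eval (p 0) ≠ 0 := hp.1.2
            have hL1p : L₁.eval (p 0) ≠ 0 := hp.2
            have hlin := hL p hp.1.1
            have hb := hpos1 p hp.1.1
            apply hfin.not_infinite
            have hc : Continuous fun t => L₀.eval t * L₁.eval t := L₀.continuous.mul L₁.continuous
            have hV : IsOpen {t : ℝ | R₃.eval t ≠ 0} := isOpen_ne_fun R₃.continuous continuous_const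
            refine OsculationCusp.infinite_of_curve
              (U := {t | 0 < t ∧ L₀.eval t * L₁.eval t < 0} ∩ {t : ℝ | R₃.eval t ≠ 0})
              (((isOpen_lt continuous_const continuous_id).inter (isOpen_lt hc continuous_const)).inter hV)
              (t₀ := p 0) ⟨⟨hpos0 p hp.1.1, ?_⟩, hR3p⟩ (fun t => -(L₀.eval t) / L₁.eval t) ?_
            · have h0 : L₀.eval (p 0) = -(L₁.eval (p 0) * p 1) := by linarith
              rw [h0]
              nlinarith [mul_self_pos.2 hL1p]
            · intro t ht
              obtain ⟨⟨htpos, hprod⟩, hR3t⟩ := ht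
              have hL1t : L₁.eval t ≠ 0 := by
                intro h0; rw [h0, mul_zero] at hprod; exact lt_irrefl _ hprod
              have hl : L₁.eval t * (-(L₀.eval t) / L₁.eval t) + L₀.eval t = 0 := by
                field_simp; ring
              have hq : R₃.eval t * (-(L₀.eval t) / L₁.eval t) ^ 3 + R₂.eval t * (-(L₀.eval t) / L₁.eval t) ^ 2
                  + R₁.eval t * (-(L₀.eval t) / L₁.eval t) + R₀.eval t = 0 := by
                have hNt : N.eval t = 0 := by rw [hNz, eval_zero]
                rw [hNq t _ hl] at hNt
                rcases mul_eq_zero.1 hNt with h | h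
                · exact absurd ((pow_eq_zero_iff (by norm_num)).1 h) hL1t
                · exact h
              have hquart : (-(L₀.eval t) / L₁.eval t) ^ 4 + (-(L₀.eval t) / L₁.eval t) ^ 3 * σ₁.eval t
                  + (-(L₀.eval t) / L₁.eval t) ^ 2 * σ₂.eval t + (-(L₀.eval t) / L₁.eval t) * σ₃.eval t
                  + σ₄.eval t = 0 := by
                have h := hEuclid t (-(L₀.eval t) / L₁.eval t)
                rw [hq, hl, mul_zero, zero_add] at h
                rcases mul_eq_zero.1 h with h' | h'
                · exact absurd ((pow_eq_zero_iff (by norm_num)).1 h') hR3t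
                · exact h'
              have hbpos : 0 < -(L₀.eval t) / L₁.eval t := by
                have h1 : -(L₀.eval t) / L₁.eval t = (-(L₀.eval t * L₁.eval t)) / (L₁.eval t * L₁.eval t) := by
                  field_simp
                rw [h1]
                exact div_pos (by linarith) (mul_self_pos.2 hL1t)
              exact hin t _ htpos hbpos hquart hq
          rw [hT1e, Set.ncard_empty]; exact Nat.zero_le _
        · refine inj_le N hNz T1 (fun p hp => ⟨hpos0 p hp.1.1, hNroot p hp.1.1⟩) ?_
          intro p hp q hq hpq
          have h1 := hL p hp.1.1
          have h2 := hL q hq.1.1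
          rw [← hpq] at h2
          have h3 : L₁.eval (p 0) * (p 1 - q 1) = 0 := by linarith
          rcases mul_eq_zero.1 h3 with h | h
          · exact absurd h hp.2
          · linarith
      calc Sg.ncard = (T0 ∪ T1).ncard := by rw [← hsplit']
        _ ≤ T0.ncard + T1.ncard := Set.ncard_union_le _ _
        _ ≤ 4 * L₁.support.card + N.support.card := Nat.add_le_add hT0c hT1c
        _ ≤ _ := by nlinarith [Nat.zero_le L₀.support.card]
  calc osc.ncard = (Sa ∪ Sg).ncard := by rw [← hsplit]
    _ ≤ Sa.ncard + Sg.ncard := Set.ncard_union_le _ _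
    _ ≤ 4 * R₃.support.card + (N.support.card + 4 * (L₁.support.card + L₀.support.card)) :=
        Nat.add_le_add hSac hSgc
    _ = _ := by ring

end OsculationCuspQuartic

end Summit.ValiantsHypothesis.ValiantsHypothesis.Theorems.LacunarySymmetroidMatrixDescartes
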